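import Literature.Analysis.Fourier.FejerRieszLemmas

/-!
# The Fejér–Riesz theorem (spectral factorisation of nonnegative trigonometric polynomials)

A trigonometric polynomial `T(θ) = Σ_{|k| ≤ n} c_k e^{ikθ}` which is real and nonnegative for every real `θ`
is the squared modulus `|Q(e^{iθ})|²` of an algebraic polynomial `Q` of degree `≤ n` [Fejér 1916, §1; the
root-pairing proof is F. Riesz's].  POLYNOMIAL FORM (the form consumed downstream, e.g. by the Boas–Kac
factorisation of sums of autocorrelations): with `p(z) = z^n T` (`natDegree p ≤ 2n`) the hypothesis is
`0 ≤ conj z ^ n * p.eval z` on the unit circle (in the `ComplexOrder`: real and nonnegative) and the conclusion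
is the identity of polynomials `p = q * conjReverse n q` (`conjReverse n q = Σ_{j ≤ n} conj (q_j) X^{n-j}`),
i.e. the coefficient sequence of `p` is the autocorrelation sequence of that of `q`; on the circle
`conj z ^ n * p z = |q z|²` (`exists_normSq_eval_eq`).  The SUM FORM `exists_eq_mul_conjReverse_of_sum`
(a finite sum `Σᵢ Qᵢ * conjReverse n Qᵢ` is a single `Q * conjReverse n Q`) is the lattice step of Boas–Kac.

Proof (Riesz): induction on `n`, see the module docstring of `FejerRieszLemmas`: `p` is conjugate-reciprocal,
so either `p(0) = 0 = p_{2n}` and we divide by `X`, or a root `α ≠ 0` comes with the root `1/conj α` (a double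
root when `|α| = 1`, by the derivative lemma), `p = (X - α)(X - 1/conj α) p₂`, and on the circle
`(z - α)(z - 1/conj α) = -(conj α)⁻¹ z |z - α|²`, so `-(conj α)⁻¹ p₂` satisfies the hypothesis at level `n - 1`.
Not here: uniqueness and the outer normalisation of `q`; operator-valued versions (Rosenblum–Rovnyak).
-/

noncomputable section

open Polynomial Filter
open _root_.Complex
open scoped ComplexConjugate ComplexOrder Topology

namespace Literature.Analysis.Fourier.FejerRiesz

/-- On the unit circle `(z - α)(z - (conj α)⁻¹) = -(conj α)⁻¹ · z · |z - α|²` (`α ≠ 0`). [folklore] -/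
theorem sub_mul_sub_inv_conj_of_norm_eq_one {α z : ℂ} (hα : α ≠ 0) (hz : ‖z‖ = 1) :
    (z - α) * (z - (conj α)⁻¹) = -(conj α)⁻¹ * z * ((z - α) * conj (z - α)) := by
  have hzz : z * conj z = 1 := mul_conj_of_norm_eq_one hz
  have hcα : conj α ≠ 0 := fun h => hα (by simpa using congrArg conj h)
  have hαα : (conj α)⁻¹ * conj α = 1 := inv_mul_cancel₀ hcα
  rw [map_sub]
  linear_combination (z - α) * (conj α)⁻¹ * hzz - (z - α) * z * hαα

/-- **Fejér–Riesz theorem** (polynomial form).  If `natDegree p ≤ 2n` and `conj z ^ n * p z` is a nonnegative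
real for every `z` on the unit circle, then `p = q * conjReverse n q` for a polynomial `q` with
`natDegree q ≤ n`. [cite: Fejer1916, §1] -/
theorem exists_eq_mul_conjReverse :
    ∀ (n : ℕ) (p : ℂ[X]), p.natDegree ≤ 2 * n → (∀ z : ℂ, ‖z‖ = 1 → 0 ≤ conj z ^ n * p.eval z) →
      ∃ q : ℂ[X], q.natDegree ≤ n ∧ p = q * conjReverse n q
  | 0, p, hdeg, hpos => by
    obtain ⟨c, rfl⟩ : ∃ c, p = C c := ⟨p.coeff 0, eq_C_of_natDegree_le_zero (by simpa using hdeg)⟩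
    have hc : 0 ≤ c := by simpa using hpos 1 (by simp)
    obtain ⟨hre, him⟩ := Complex.nonneg_iff.mp hc
    refine ⟨C ((Real.sqrt c.re : ℝ) : ℂ), (natDegree_C _).le, ?_⟩
    refine eq_mul_conjReverse_of_eval (natDegree_C _).le fun z hz => ?_
    rw [eval_C, eval_C, conj_ofReal, pow_zero, one_mul, ← ofReal_mul, Real.mul_self_sqrt hre]
    exact Complex.ext (by simp) (by simp [← him])
  | n + 1, p, hdeg, hpos => by
    have h2 : 2 * (n + 1) = 2 * n + 2 := by ring
    rw [h2] at hdeg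
    -- conjugate-reciprocity and its consequence for the extreme coefficients
    have hsym : conjReverse (2 * n + 2) p = p := by
      have := conjReverse_eq_self_of_nonneg (m := n + 1) (h2 ▸ hdeg) hpos
      rwa [h2] at this
    have htop : p.coeff (2 * n + 2) = conj (p.coeff 0) := by
      conv_lhs => rw [← hsym]
      rw [coeff_conjReverse p le_rfl, Nat.sub_self]
    by_cases h0 : p.coeff 0 = 0
    · /- Case A: `p(0) = 0`; then the top coefficient vanishes too, `p = X · p'` with `natDegree p' ≤ 2n`,
        and `conj z^n p'(z) = conj z^(n+1) p(z) ≥ 0`. -/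
      have hdeg' : p.natDegree ≤ 2 * n + 1 := by
        refine (natDegree_le_iff_coeff_eq_zero).mpr fun N hN => ?_
        rcases (Nat.lt_or_ge (2 * n + 2) N) with hlt | hge
        · exact coeff_eq_zero_of_natDegree_lt (hdeg.trans_lt hlt)
        · have hN' : N = 2 * n + 2 := by omega
          rw [hN', htop, h0, map_zero]
      obtain ⟨p', hp'⟩ := X_dvd_iff.mpr h0
      have hdegp' : p'.natDegree ≤ 2 * n := by
        by_cases hp0 : p' = 0
        · simp [hp0]
        · have := natDegree_X_mul hp0
          rw [← hp'] at this
          omega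
      have hpos' : ∀ z : ℂ, ‖z‖ = 1 → 0 ≤ conj z ^ n * p'.eval z := by
        intro z hz
        have h := hpos z hz
        rw [hp', eval_mul, eval_X, pow_succ] at h
        calc (0 : ℂ) ≤ conj z ^ n * conj z * (z * p'.eval z) := h
          _ = conj z ^ n * p'.eval z := by
            rw [mul_assoc, ← mul_assoc (conj z), conj_mul_of_norm_eq_one hz, one_mul]
      obtain ⟨q, hq, hpq⟩ := exists_eq_mul_conjReverse n p' hdegp' hpos'
      refine ⟨q, hq.trans (Nat.le_succ n), ?_⟩
      refine eq_mul_conjReverse_of_eval (hq.trans (Nat.le_succ n)) fun z hz => ?_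
      have hev : p'.eval z = q.eval z * (z ^ n * conj (q.eval z)) := by
        conv_lhs => rw [hpq]
        rw [eval_mul, eval_conjReverse_circle hq hz]
      rw [hp', eval_mul, eval_X, hev]
      ring
    · /- Case B: `p(0) ≠ 0`; pick a root `α ≠ 0`, then `β = (conj α)⁻¹` is a root of `p / (X - α)`
        (a second root if `β ≠ α`, a double root by the derivative lemma if `β = α`). -/
      have hp0 : p ≠ 0 := fun h => h0 (by simp [h])
      have hdegpos : 0 < p.degree := by
        have htop0 : p.coeff (2 * n + 2) ≠ 0 := by rwa [htop, map_ne_zero_iff _ (RingHom.injective _)]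
        exact lt_of_lt_of_le (by exact_mod_cast Nat.succ_pos _) (le_degree_of_ne_zero htop0)
      obtain ⟨α, hαroot⟩ := Complex.exists_root hdegpos
      have hα0 : α ≠ 0 := by
        rintro rfl
        exact h0 (by rwa [coeff_zero_eq_eval_zero])
      have hcα0 : conj α ≠ 0 := fun h => hα0 (by simpa using congrArg conj h)
      set β : ℂ := (conj α)⁻¹ with hβ
      have hβ0 : β ≠ 0 := inv_ne_zero hcα0
      have hβroot : p.eval β = 0 := by
        conv_lhs => rw [← hsym]
        rw [eval_conjReverse hdeg hβ0, hβ, map_inv₀, Complex.conj_conj, inv_inv, hαroot.eq_zero, map_zero,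
          mul_zero]
      -- first division
      set p₁' : ℂ[X] := p /ₘ (X - C α) with hp₁'
      have hfac₁ : (X - C α) * p₁' = p := mul_divByMonic_eq_iff_isRoot.mpr hαroot
      have hp₁'β : p₁'.eval β = 0 := by
        by_cases hβα : β = α
        · -- double root: `p'(α) = 0` and `p' = p₁' + (X - α) p₁''`
          have hder : (derivative p).eval α = 0 := by
            refine eval_derivative_eq_zero_of_nonneg hpos ?_ hαroot.eq_zero
            -- `‖α‖ = 1` since `(conj α)⁻¹ = α`
            have h1 : conj α * α = 1 :=
              calc conj α * α = conj α * β := by rw [hβα]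
                _ = 1 := by rw [hβ]; exact mul_inv_cancel₀ hcα0
            have h2 : (normSq α : ℂ) = 1 := by rw [← mul_conj, mul_comm, h1]
            have h3 : ‖α‖ ^ 2 = 1 := by rw [← normSq_eq_norm_sq]; exact_mod_cast h2
            nlinarith [norm_nonneg α]
          have hd : derivative p = p₁' + (X - C α) * derivative p₁' := by
            conv_lhs => rw [← hfac₁]
            rw [derivative_mul, derivative_sub, derivative_X, derivative_C, sub_zero, one_mul]
          rw [hβα]
          have := hder
          rw [hd, eval_add, eval_mul, eval_sub, eval_X, eval_C, sub_self, zero_mul, add_zero] at this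
          exact this
        · have h := hβroot
          rw [← hfac₁, eval_mul, eval_sub, eval_X, eval_C] at h
          rcases mul_eq_zero.mp h with h | h
          · exact absurd (sub_eq_zero.mp h) hβα
          · exact h
      -- second division
      set p₂ : ℂ[X] := p₁' /ₘ (X - C β) with hp₂
      have hfac₂ : (X - C β) * p₂ = p₁' := mul_divByMonic_eq_iff_isRoot.mpr hp₁'β
      have hfac : p = (X - C α) * ((X - C β) * p₂) := by rw [hfac₂, hfac₁]
      have hp₂0 : p₂ ≠ 0 := by
        intro h; apply hp0; rw [hfac, h, mul_zero, mul_zero]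
      have hdeg₂ : p₂.natDegree ≤ 2 * n := by
        have h := congrArg natDegree hfac
        rw [natDegree_mul (X_sub_C_ne_zero α) (mul_ne_zero (X_sub_C_ne_zero β) hp₂0),
          natDegree_mul (X_sub_C_ne_zero β) hp₂0, natDegree_X_sub_C, natDegree_X_sub_C] at h
        omega
      -- the renormalised quotient `p₁ = -(conj α)⁻¹ p₂`
      set p₁ : ℂ[X] := C (-(conj α)⁻¹) * p₂ with hp₁
      have hdeg₁ : p₁.natDegree ≤ 2 * n := (natDegree_C_mul_le _ _).trans hdeg₂
      -- the key circle identity `conj z^(n+1) p z = |z - α|² · conj z^n p₁ z`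
      have hkey : ∀ z : ℂ, ‖z‖ = 1 →
          conj z ^ (n + 1) * p.eval z = (normSq (z - α) : ℂ) * (conj z ^ n * p₁.eval z) := by
        intro z hz
        have hprod : (z - α) * (z - β) = -(conj α)⁻¹ * z * ((z - α) * conj (z - α)) := by
          rw [hβ]; exact sub_mul_sub_inv_conj_of_norm_eq_one hα0 hz
        have hzz : conj z * z = 1 := conj_mul_of_norm_eq_one hz
        rw [hfac, hp₁]
        simp only [eval_mul, eval_sub, eval_X, eval_C]
        rw [← mul_conj, pow_succ]
        linear_combination (conj z ^ n * conj z * p₂.eval z) * hprod +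
          (-(conj α)⁻¹) * conj z ^ n * ((z - α) * conj (z - α)) * p₂.eval z * hzz
      have hpos₁ : ∀ z : ℂ, ‖z‖ = 1 → 0 ≤ conj z ^ n * p₁.eval z := by
        intro z hz
        refine nonneg_on_circle_of_nonneg_off_point (g := fun w => conj w ^ n * p₁.eval w)
          ((Complex.continuous_conj.pow n).mul (Polynomial.continuous _)) α (fun w hw hwα => ?_) hz
        have hn : 0 < normSq (w - α) := normSq_pos.mpr (sub_ne_zero.mpr hwα)
        have hne : (normSq (w - α) : ℂ) ≠ 0 := by exact_mod_cast hn.ne'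
        have h := nonneg_div_ofReal (hpos w hw) hn
        rwa [hkey w hw, mul_comm, mul_div_assoc, div_self hne, mul_one] at h
      obtain ⟨q₁, hq₁, hpq₁⟩ := exists_eq_mul_conjReverse n p₁ hdeg₁ hpos₁
      refine ⟨(X - C α) * q₁, ?_, ?_⟩
      · calc ((X - C α) * q₁).natDegree ≤ (X - C α).natDegree + q₁.natDegree := natDegree_mul_le
          _ ≤ 1 + n := Nat.add_le_add (natDegree_X_sub_C α).le hq₁
          _ = n + 1 := Nat.add_comm 1 n
      · refine eq_mul_conjReverse_of_eval ?_ fun z hz => ?_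
        · calc ((X - C α) * q₁).natDegree ≤ (X - C α).natDegree + q₁.natDegree := natDegree_mul_le
            _ ≤ 1 + n := Nat.add_le_add (natDegree_X_sub_C α).le hq₁
            _ = n + 1 := Nat.add_comm 1 n
        -- multiply `hkey` by `z^(n+1)` and unfold `p₁ = q₁ · conjReverse n q₁` on the circle
        have hzz : z * conj z = 1 := mul_conj_of_norm_eq_one hz
        have h1 : p.eval z = z ^ (n + 1) * (conj z ^ (n + 1) * p.eval z) := by
          rw [← mul_assoc, ← mul_pow, hzz, one_pow, one_mul]
        have h2 : conj z ^ n * p₁.eval z = (normSq (q₁.eval z) : ℂ) := by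
          conv_lhs => rw [hpq₁]
          exact conj_pow_mul_eval_mul_conjReverse hq₁ hz
        rw [h1, hkey z hz, h2, ← mul_conj, ← mul_conj, eval_mul, eval_sub, eval_X, eval_C, map_mul]
        ring

/-- **Fejér–Riesz theorem** (circle form): under the same hypotheses `conj z ^ n * p z = |q z|²` on the unit
circle. [cite: Fejer1916, §1] -/
theorem exists_normSq_eval_eq {n : ℕ} {p : ℂ[X]} (hdeg : p.natDegree ≤ 2 * n)
    (hpos : ∀ z : ℂ, ‖z‖ = 1 → 0 ≤ conj z ^ n * p.eval z) :
    ∃ q : ℂ[X], q.natDegree ≤ n ∧ ∀ z : ℂ, ‖z‖ = 1 → conj z ^ n * p.eval z = (normSq (q.eval z) : ℂ) := by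
  obtain ⟨q, hq, hpq⟩ := exists_eq_mul_conjReverse n p hdeg hpos
  exact ⟨q, hq, fun z hz => by rw [hpq]; exact conj_pow_mul_eval_mul_conjReverse hq hz⟩

/-- **Fejér–Riesz theorem, sum form** (the lattice step of the Boas–Kac factorisation): a finite sum
`Σᵢ Qᵢ * conjReverse n Qᵢ` (`natDegree Qᵢ ≤ n`) — whose coefficient sequence is the sum of the
autocorrelation sequences of the `Qᵢ` — equals a single `Q * conjReverse n Q` with `natDegree Q ≤ n`.
[cite: Fejer1916, §1] -/
theorem exists_eq_mul_conjReverse_of_sum {ι : Type*} (s : Finset ι) (Q : ι → ℂ[X]) (n : ℕ)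
    (hQ : ∀ i ∈ s, (Q i).natDegree ≤ n) :
    ∃ q : ℂ[X], q.natDegree ≤ n ∧ ∑ i ∈ s, Q i * conjReverse n (Q i) = q * conjReverse n q := by
  refine exists_eq_mul_conjReverse n _ ?_ fun z hz => ?_
  · refine natDegree_sum_le_of_forall_le _ _ fun i hi => ?_
    calc (Q i * conjReverse n (Q i)).natDegree ≤ (Q i).natDegree + (conjReverse n (Q i)).natDegree :=
          natDegree_mul_le
      _ ≤ n + n := Nat.add_le_add (hQ i hi) (natDegree_conjReverse_le (hQ i hi))
      _ = 2 * n := (two_mul n).symm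
  · rw [eval_finsetSum, Finset.mul_sum]
    exact Finset.sum_nonneg fun i hi => by
      rw [conj_pow_mul_eval_mul_conjReverse (hQ i hi) hz]
      exact_mod_cast normSq_nonneg _

end Literature.Analysis.Fourier.FejerRiesz

end
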